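import Mathlib.RingTheory.PowerSeries.Binomial
import Mathlib.NumberTheory.Padics.MahlerBasis
import Literature.NumberTheory.EllipticCurves.BigGaloisRepLocalInputs
import HarnessLib

/-!
# The Iwasawa character `Ψ : Γ_K ↠ Γ ↪ Λ_𝒪^×`, `σ ↦ (1 + T)^{κ σ}` ("`1 + T ↦ γ`"), and
# `(1 + T)^a ∈ Λ_𝒪^×` for `a ∈ ℤ_p`

Cell `bsd-stepL` (crux `stmt-BirchSwinnertonDyer-19270`, Road FF): the character through which `Γ_K`
acts on `Λ_𝒪^*` in `M = T ⊗_𝒪 Λ_𝒪^*(Ψ⁻¹)` and at which the `Σ`-Euler factors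
`P_w(ε⁻¹Ψ⁻¹(Frob_w))` of the `Σ`-imprimitive `p`-adic `L`-functions are evaluated ([Cas18, (3.1)],
[Ski16, p. 180]) — the vocabulary the fact files F3/F4/F7 of the crux need. DEFINITIONS WITH BODIES
and proved lemmas only; no named fact, no `sorry`, no instance, no notation.

## Source, verbatim

* F. Castella, Camb. J. Math. 6 (2018) §2.1 (p. 4): "Letting `ρ_{E,p}` denote the natural action of
  `G_K` on `T`, the `G_K`-action on `𝒜` is given by `ρ_{E,p} ⊗ Ψ⁻¹`, where `Ψ` is the composite
  character `G_K ↠ Γ ↪ Λ^×`"; §2.2 (p. 5): "`γ ∈ Γ` a fixed topological generator … we identify the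
  one-variable power series ring `ℤ_p[[T]]` with the Iwasawa algebra `Λ = ℤ_p[[Γ]]` by sending
  `1 + T ↦ γ`".
* C. Skinner, Pacific J. Math. 283 (2016) §2.3 (p. 178): "Let `Ψ : G_ℚ ↠ Γ ⊂ Λ_𝒪^×` be the natural
  projection. This is a continuous `Λ_𝒪`-valued character that is unramified away from `p` and
  totally ramified at `p`."

## What is defined (namespace `Literature.NumberTheory.EllipticCurves.IwasawaCharacter`)

* `onePlusTPow p 𝒪 a = (1 + T)^a ∈ (PowerSeries 𝒪)ˣ` for `a ∈ ℤ_p` (Mathlib's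
  `PowerSeries.binomialSeries 𝒪 a = ∑ₙ (a choose n) Tⁿ` over the binomial ring `ℤ_p`, inverse
  `(1 + T)^{−a}`), `onePlusTPow_add/neg/zero/nsmul`, `val_onePlusTPow_one = 1 + T`,
  `X ∣ (1+T)^a − 1`; `onePlusTPowHom : Multiplicative ℤ_p →* Λ_𝒪^×` (`γ^a ↦ (1+T)^a`).
* **`Psi p 𝒪 κ : Γ_K →* Λ_𝒪^×`**, `σ ↦ (1 + T)^{κ σ}`, for a `ℤ_p`-extension `κ : Γ_K ↠ ℤ_p`
  (`ZpExtension`); `val_Psi_of_isTopGenerator : Ψ γ = 1 + T` for `κ γ = 1`; `Psi_eq_one_of`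
  (`Ψ` trivial on `ker κ = Gal(K̄/K_∞)`); **`Psi_localMap_inr`: `Ψ` is unramified away from `p`**
  (trivial on the inertia indices `w ∤ p` of `BigGaloisRep.localMap`, from
  `ZpExtension.apply_localMap_inr`).
* Link with the landed co-induced model (`AnticyclotomicBigGaloisRep.lean`, where `Λ_𝒪` acts on
  `C^∞(ℤ_p, A)` with `(1 + T)·Φ = Φ(· + 1)`): `onePlusX_smul : (1 + T) • Φ = translate 1 Φ` and
  `onePlusX_pow_smul : (1 + T)^n • Φ = translate n Φ`, so `(g·Φ)(x) = ρ(g)Φ(x − κ g)` is indeed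
  `ρ ⊗ Ψ⁻¹` on `Λ^*`-valued functions (`[γ^a]·Φ = Φ(· + a)`).

References: [Castella2018] §2.1–2.2 (pp. 4–5); [Skinner2016PacificMC] §2.3 (p. 178);
[Castella2018Erratum] §2 (p. 2, "`G_K` acts on `Λ_𝒪^*` via `Ψ⁻¹`"); [Washington1997] Prop. 13.2.
-/

noncomputable section

open Field IsDedekindDomain NumberField
open Literature.NumberTheory.EllipticCurves Literature.NumberTheory.EllipticCurves.BigGaloisRep
open Literature.NumberTheory.GaloisRepresentations

universe u v

namespace Literature.NumberTheory.EllipticCurves.IwasawaCharacter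

section Character

variable (p : ℕ) [Fact p.Prime] (𝒪 : Type v) [CommRing 𝒪] [Algebra ℤ_[p] 𝒪]

/-- `(1 + T)^a ∈ Λ_𝒪^×` for a `p`-adic exponent `a ∈ ℤ_p` (Mathlib's binomial power series
`∑ₙ (a choose n) Tⁿ` over the binomial ring `ℤ_p`, with inverse `(1 + T)^{-a}`) — the image of
`γ^a ∈ Γ` under "`1 + T ↦ γ`". [cite: Castella2018, §2.2 (p. 5, "`ℤ_p[[T]] ≅ Λ = ℤ_p[[Γ]]`, `1 + T ↦ γ`")] -/
def onePlusTPow (a : ℤ_[p]) : (PowerSeries 𝒪)ˣ where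
  val := PowerSeries.binomialSeries 𝒪 a
  inv := PowerSeries.binomialSeries 𝒪 (-a)
  val_inv := by
    rw [← PowerSeries.binomialSeries_add, add_neg_cancel, PowerSeries.binomialSeries_zero]
  inv_val := by
    rw [← PowerSeries.binomialSeries_add, neg_add_cancel, PowerSeries.binomialSeries_zero]

/-- Unfolding `onePlusTPow`: `(1+T)^a = ∑ₙ (a choose n) Tⁿ`. [cite: Castella2018, §2.2 (p. 5, "`1 + T ↦ γ`")] -/
@[simp] theorem val_onePlusTPow (a : ℤ_[p]) :
    (onePlusTPow p 𝒪 a : PowerSeries 𝒪) = PowerSeries.binomialSeries 𝒪 a :=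
  rfl

/-- Unfolding the inverse: `((1+T)^a)⁻¹ = (1+T)^{-a}`. [cite: Castella2018, §2.2 (p. 5, "`1 + T ↦ γ`")] -/
@[simp] theorem val_inv_onePlusTPow (a : ℤ_[p]) :
    (((onePlusTPow p 𝒪 a)⁻¹ : (PowerSeries 𝒪)ˣ) : PowerSeries 𝒪) = PowerSeries.binomialSeries 𝒪 (-a) :=
  rfl

/-- `(1+T)^0 = 1` (`γ^0 = 1`). [cite: Castella2018, §2.2 (p. 5, "`1 + T ↦ γ`")] -/
@[simp] theorem onePlusTPow_zero : onePlusTPow p 𝒪 0 = 1 :=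
  Units.ext (PowerSeries.binomialSeries_zero)

/-- `(1+T)^{a+b} = (1+T)^a (1+T)^b` (`γ^{a+b} = γ^a γ^b`; Vandermonde in the binomial ring `ℤ_p`).
[cite: Castella2018, §2.2 (p. 5, "`1 + T ↦ γ`")] -/
theorem onePlusTPow_add (a b : ℤ_[p]) :
    onePlusTPow p 𝒪 (a + b) = onePlusTPow p 𝒪 a * onePlusTPow p 𝒪 b :=
  Units.ext (PowerSeries.binomialSeries_add a b)

/-- `(1+T)^{-a} = ((1+T)^a)⁻¹`. [cite: Castella2018, §2.2 (p. 5, "`1 + T ↦ γ`")] -/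
theorem onePlusTPow_neg (a : ℤ_[p]) : onePlusTPow p 𝒪 (-a) = (onePlusTPow p 𝒪 a)⁻¹ :=
  Units.ext rfl

/-- `(1+T)^{n • a} = ((1+T)^a)^n`. [cite: Castella2018, §2.2 (p. 5, "`1 + T ↦ γ`")] -/
theorem onePlusTPow_nsmul (n : ℕ) (a : ℤ_[p]) :
    onePlusTPow p 𝒪 (n • a) = onePlusTPow p 𝒪 a ^ n := by
  induction n with
  | zero => rw [zero_smul, onePlusTPow_zero, pow_zero]
  | succ n ih => rw [succ_nsmul, onePlusTPow_add, ih, pow_succ]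

/-- `(1+T)^1 = 1 + T` (`γ ↦ 1 + T`). [cite: Castella2018, §2.2 (p. 5, "`1 + T ↦ γ`")] -/
theorem val_onePlusTPow_one : (onePlusTPow p 𝒪 1 : PowerSeries 𝒪) = 1 + PowerSeries.X := by
  rw [val_onePlusTPow, show (1 : ℤ_[p]) = ((1 : ℕ) : ℤ_[p]) by norm_num,
    PowerSeries.binomialSeries_nat, pow_one]

/-- `(1+T)^a ≡ 1 mod T`: the constant coefficient of `(1+T)^a` is `1` (`γ^a ↦ 1` under the
augmentation `T ↦ 0`). [cite: Castella2018, §2.2 (p. 5, "`1 + T ↦ γ`")] -/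
theorem X_dvd_val_onePlusTPow_sub_one (a : ℤ_[p]) :
    (PowerSeries.X : PowerSeries 𝒪) ∣ (onePlusTPow p 𝒪 a : PowerSeries 𝒪) - 1 := by
  rw [PowerSeries.X_dvd_iff, map_sub, val_onePlusTPow, PowerSeries.binomialSeries_constantCoeff,
    map_one, sub_self]

/-- `a ↦ (1+T)^a` as a group homomorphism `ℤ_p → Λ_𝒪^×` (from the additive group, written
multiplicatively). [cite: Castella2018, §2.2 (p. 5, `1 + T ↦ γ`)] -/
def onePlusTPowHom : Multiplicative ℤ_[p] →* (PowerSeries 𝒪)ˣ where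
  toFun a := onePlusTPow p 𝒪 a.toAdd
  map_one' := by rw [toAdd_one, onePlusTPow_zero]
  map_mul' a b := by rw [toAdd_mul, onePlusTPow_add]

/-- Unfolding `onePlusTPowHom`. [cite: Castella2018, §2.2 (p. 5, "`1 + T ↦ γ`")] -/
@[simp] theorem onePlusTPowHom_apply (a : Multiplicative ℤ_[p]) :
    onePlusTPowHom p 𝒪 a = onePlusTPow p 𝒪 a.toAdd :=
  rfl

variable {K : Type u} [Field K]

/-- **`Ψ : Γ_K → Λ_𝒪^×`, `σ ↦ (1 + T)^{κ σ}`** — Castella's "composite character `G_K ↠ Γ ↪ Λ^×`"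
for the `ℤ_p`-extension cut out by `κ : Γ_K ↠ ℤ_p`, under the identification `γ ↦ 1 + T` of
`ℤ_p[[Γ]]` with `ℤ_p⟦T⟧` for the topological generator `γ` with `κ γ = 1`
(`ZpExtension.IsTopGenerator`). [cite: Castella2018, §2.1–2.2 (pp. 4–5, "`Ψ` is the composite character `G_K ↠ Γ ↪ Λ^×`", "`1 + T ↦ γ`")] -/
def Psi (κ : ZpExtension K p) : absoluteGaloisGroup K →* (PowerSeries 𝒪)ˣ :=
  (onePlusTPowHom p 𝒪).comp κ.toContinuousMonoidHom.toMonoidHom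

/-- Unfolding `Ψ`: `Ψ σ = (1+T)^{κ σ}`. [cite: Castella2018, §2.1 (p. 4)] -/
@[simp] theorem Psi_apply (κ : ZpExtension K p) (σ : absoluteGaloisGroup K) :
    Psi p 𝒪 κ σ = onePlusTPow p 𝒪 (κ σ).toAdd :=
  rfl

/-- `Ψ γ = 1 + T` for a topological generator `γ` (`κ γ = 1`): the normalisation `1 + T ↦ γ`.
[cite: Castella2018, §2.2 (p. 5, "`1 + T ↦ γ`")] -/
theorem val_Psi_of_isTopGenerator (κ : ZpExtension K p) {γ : absoluteGaloisGroup K}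
    (hγ : κ.IsTopGenerator γ) : (Psi p 𝒪 κ γ : PowerSeries 𝒪) = 1 + PowerSeries.X := by
  rw [Psi_apply, show (κ γ).toAdd = 1 from congrArg Multiplicative.toAdd hγ, val_onePlusTPow_one]

end Character

/-! ### `Ψ` is trivial on `Gal(K̄/K_∞)` and unramified away from `p` -/

section Unramified

variable (p : ℕ) [Fact p.Prime] (𝒪 : Type v) [CommRing 𝒪] [Algebra ℤ_[p] 𝒪]
variable {K : Type u} [Field K]

/-- `Ψ σ = 1` when `κ σ = 1` (in particular on `Gal(K̄/K_∞) = ker κ`).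
[cite: Castella2018, §2.1 (p. 4, "`Ψ` is the composite character `G_K ↠ Γ ↪ Λ^×`")] -/
theorem Psi_eq_one_of (κ : ZpExtension K p) {σ : absoluteGaloisGroup K} (hσ : κ σ = 1) :
    Psi p 𝒪 κ σ = 1 := by
  rw [Psi_apply, hσ, toAdd_one, onePlusTPow_zero]

/-- **`Ψ` is unramified away from `p`**: for a number field `K`, a finite place `w ∤ p` and `σ` in
the local inertia group `I_{K_w}` (the inertia index `Sum.inr w` of `BigGaloisRep.localMap`),
`Ψ(σ) = 1` — `ℤ_p`-extensions are unramified outside `p` (`ZpExtension.apply_localMap_inr`).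
[cite: Skinner2016PacificMC, §2.3 (p. 178, "unramified away from `p`")] [cite: Washington1997, Prop. 13.2] -/
theorem Psi_localMap_inr [NumberField K] (κ : ZpExtension K p) {w : HeightOneSpectrum (𝓞 K)}
    (hw : ((p : ℕ) : 𝓞 K) ∉ w.asIdeal) (σ : LocalGroup K (Sum.inr w)) :
    Psi p 𝒪 κ (localMap K (Sum.inr w) σ) = 1 :=
  Psi_eq_one_of p 𝒪 κ (ZpExtension.apply_localMap_inr κ hw σ)

end Unramified

/-! ### Link with the co-induced model: `(1 + T)^n` acts on `C^∞(ℤ_p, A)` by translation -/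

section Model

variable {p : ℕ} [Fact p.Prime] {𝒪 : Type v} [CommRing 𝒪]
variable {A : Type*} [AddCommGroup A] [Module 𝒪 A]

/-- `(1 + T) • Φ = τ₁ Φ = Φ(· + 1)` on the landed module `BigRepModule 𝒪 p A` (`X • Φ = τ₁Φ − Φ`,
`AnticyclotomicBigGaloisRep.X_smul`): the identification "`1 + T ↦ γ`" with `γ` acting on
`Λ^* = C^∞(Γ, ·)` by translation. [cite: Castella2018, §2.2 (p. 5, "`1 + T ↦ γ`")] -/
theorem onePlusX_smul (Φ : BigRepModule 𝒪 p A) :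
    ((1 : PowerSeries 𝒪) + PowerSeries.X) • Φ = BigRepModule.translate 1 Φ := by
  rw [add_smul, one_smul, BigRepModule.X_smul, BigRepModule.shiftSubOne, LinearMap.sub_apply,
    LinearMap.id_apply, add_sub_cancel]

/-- `(1 + T)^n • Φ = τ_n Φ = Φ(· + n)`: `[γ^n] ∈ Λ` acts on `Λ^*`-valued functions by translation
by `n` (so `g` acts through `Ψ(g)⁻¹` on the `Λ^*`-factor of the landed `bigRep`,
`(g·Φ)(x) = ρ(g)Φ(x − κ g)`). [cite: Castella2018, §2.1–2.2 (pp. 4–5, "`ρ_{E,p} ⊗ Ψ⁻¹`", "`1 + T ↦ γ`")] -/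
theorem onePlusX_pow_smul (n : ℕ) (Φ : BigRepModule 𝒪 p A) :
    (((1 : PowerSeries 𝒪) + PowerSeries.X) ^ n) • Φ = BigRepModule.translate (n : ℤ_[p]) Φ := by
  induction n with
  | zero => rw [pow_zero, one_smul, Nat.cast_zero, BigRepModule.translate_zero, LinearMap.id_apply]
  | succ n ih =>
    rw [pow_succ', mul_smul, ih, onePlusX_smul, Nat.cast_succ, add_comm (n : ℤ_[p]) 1,
      BigRepModule.translate_add, LinearMap.comp_apply]

/-- For `a = n ∈ ℕ ⊂ ℤ_p`: `(1+T)^a • Φ = Φ(· + n)` with `(1+T)^a = onePlusTPow p 𝒪 n` the binomial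
power series (`PowerSeries.binomialSeries_nat`). [cite: Castella2018, §2.2 (p. 5, "`1 + T ↦ γ`")] -/
theorem onePlusTPow_natCast_smul [Algebra ℤ_[p] 𝒪] (n : ℕ) (Φ : BigRepModule 𝒪 p A) :
    (onePlusTPow p 𝒪 (n : ℤ_[p]) : PowerSeries 𝒪) • Φ = BigRepModule.translate (n : ℤ_[p]) Φ := by
  rw [val_onePlusTPow, PowerSeries.binomialSeries_nat, onePlusX_pow_smul]

end Model

end Literature.NumberTheory.EllipticCurves.IwasawaCharacter

end
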